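import Literature.Barriers.AtomisticToContinuum.FlexibleKissingArrangements
import HarnessLib

/-!
# The twisted-square completion of the hcp own-pattern `1743` (SLOTEX, cf-p1 ROUTE.md §79a/§80)

Helper for `stmt-Ventures-19480` (GenericWallFloor; general-filling step, per-ball programme E1/E2):
a KERNEL WITNESS that «saturation ⇒ exact capping» FAILS for an hcp-type ball with EIGHT exact own
neighbours forming the pattern `1743` = the contiguous half of the anticuboctahedron on one side
of a prism plane (hexagon vectors at azimuth `0°, 60°, 120°, 180°`, the polar vectors above and
below azimuths `30°` and `150°`).  Found numerically by cf-p1's SLOTEX census (kit j288373, mask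
1743: a twisted 4-cluster completes the kissing dozen, slack `0.13°`, `≈ 30°` off every exact
position); here rounded to INTEGER vectors on the sphere `x² + y² + z² = 18·8655²` (lit g11, kit
j289726) and checked by `decide`.

In the cubic frame of `Literature.Geometry.DiscreteGeometry.hcpInt` (hexagonal layer `x+y+z = 0`,
polar axis `(1,1,1)`), scale `k = 8655`, `N = 18k² = 1348362450`:
* own pattern `O₁₇₄₃ = k·{(3,0,−3), (0,3,−3), (−3,3,0), (−3,0,3), (3,3,0), (0,3,3), (−1,−1,−4), (−4,−1,−1)}`
  (`13` bonds among them);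
* twisted square `F = {(33660,−12429,7803), (−11553,−31785,14304), (11553,−31785,−14304), (8720,−8761,34577)}`
  — two orbits under the pattern's symmetry `C₂ = ⅓[[−2,−2,1],[−2,1,−2],[1,−2,−2]]`.

PROVED: `O ∪ F` (scaled by `1/√N`) is a kissing arrangement of twelve unit vectors
(`isKissingArrangement_twistedDozen`) containing the eight own vectors, which are eight of the
twelve HCP vectors (`hcpOwn1743_subset_hcp`, `hcpOwn1743_subset_twistedDozen`); each ball of `F`
is at distance `> 1001/1000` from every other ball (touches nothing: `lt_dist_of_mem_twistedFour`)
and `≥ 9/20` (`27°`) from EVERY vector of the HCP pattern (`le_dist_twistedFour_hcp`); the dozen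
has `13` bonds (`26` ordered contact pairs, all inside `O`: `card_contactPairs_twistedDozen`) hence is
NOT a linear-isometric image of the FCC or of the HCP pattern (`twistedDozen_not_isometricImage`,
both have `48`); and the four free balls may be moved freely by `1/2500` (`isKissingArrangement_own_union_of_etaMatched`).
Consequently (one line once cf-p1's `ExactOnly` of ExactOnlySketch.lean is in the tree):
`¬ ExactOnly 0 hcpOwn1743`.

By monotonicity the same dozen refutes exact-only for the three seven-point violators `719`,
`1735`, `1739` = the sub-patterns of `1743` (`hcpOwn7_not_exactOnly`).
Sequels: `…GenericWallFloorTwistedSquareSeven` (the three seven-point sub-patterns `719/1735/1739` of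
`1743`) and `…GenericWallFloorAdatomRow` (the fcc own-pattern `111`, a `(100)` adatom-row ball, `|O| = 6`:
a contact-free non-exact completion and a twin-snapped one).  Kernel witnesses by the cell's literature
seat (lit g11, evidence #40/#42/#43 on stmt-Ventures-19480), landed by a prover seat (Theorems are prover-only).

WHAT THIS IS NOT: anything about own-patterns with `≥ 9` hcp vectors / `≥ 7` fcc vectors (SLOTEX: exact-only,
to be certified by E1); not a wall law; F-C1 not moved.  Companion (Literature, printed case):
`Literature/Barriers/AtomisticToContinuum/FccShellUnlocking.lean` (fcc, two polar triples fixed,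
Kusner–Kusner–Lagarias–Shlosman 2018).
-/

noncomputable section

namespace Summit.Ventures.Crystal3D.Theorems

open Finset Literature.Geometry.DiscreteGeometry Literature.Barriers.AtomisticToContinuum

/-- Euclidean `3`-space. -/
local notation "E3" => EuclideanSpace ℝ (Fin 3)

/-! ### Plumbing: rescaling and two-set distance bounds for integer models -/

/-- Integer-model bookkeeping for the kernel witness (checked by `decide` / rescaling). -/
private theorem intVec_zsmul (k : ℤ) (v : Fin 3 → ℤ) : intVec (k • v) = (k : ℝ) • intVec v := by
  ext i
  simp [intVec]

/-- Integer-model bookkeeping for the kernel witness (checked by `decide` / rescaling). -/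
private theorem scaledPattern_rescale (S : Finset (Fin 3 → ℤ)) {k : ℕ} (hk : k ≠ 0) (N : ℕ) :
    scaledPattern (S.image fun v => (k : ℤ) • v) (k ^ 2 * N) = scaledPattern S N := by
  unfold scaledPattern
  rw [Finset.image_image]
  refine Finset.image_congr fun v _ => ?_
  have hk' : (0 : ℝ) < k := by exact_mod_cast Nat.pos_of_ne_zero hk
  have hsq : Real.sqrt ((k ^ 2 * N : ℕ) : ℝ) = k * Real.sqrt N := by
    push_cast
    rw [Real.sqrt_mul (by positivity), Real.sqrt_sq hk'.le]
  show (Real.sqrt ((k ^ 2 * N : ℕ) : ℝ))⁻¹ • intVec ((k : ℤ) • v) = (Real.sqrt N)⁻¹ • intVec v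
  rw [hsq, intVec_zsmul, smul_smul, Int.cast_natCast]
  congr 1
  field_simp

/-- Integer-model bookkeeping for the kernel witness (checked by `decide` / rescaling). -/
private theorem le_dist_of_mem_scaledPattern₂ {S S' : Finset (Fin 3 → ℤ)} {N M : ℕ}
    (hS : ∀ v ∈ S, ∀ w ∈ S', v ≠ w → (M : ℤ) ≤ sqNormInt (v - w)) {x y : E3}
    (hx : x ∈ scaledPattern S N) (hy : y ∈ scaledPattern S' N) (hxy : x ≠ y) :
    (Real.sqrt N)⁻¹ * Real.sqrt M ≤ dist x y := by
  obtain ⟨v, hv, rfl⟩ := Finset.mem_image.1 hx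
  obtain ⟨w, hw, rfl⟩ := Finset.mem_image.1 hy
  have hvw : v ≠ w := fun h => hxy (by rw [h])
  rw [dist_scaled]
  refine mul_le_mul_of_nonneg_left (Real.sqrt_le_sqrt ?_) (inv_nonneg.2 (Real.sqrt_nonneg _))
  exact_mod_cast hS v hv w hw hvw

/-- Integer-model bookkeeping for the kernel witness (checked by `decide` / rescaling). -/
private theorem le_dist_of_mem_scaledPattern₂' {S S' : Finset (Fin 3 → ℤ)} {N M : ℕ}
    (hS : ∀ v ∈ S, ∀ w ∈ S', (M : ℤ) ≤ sqNormInt (v - w)) {x y : E3}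
    (hx : x ∈ scaledPattern S N) (hy : y ∈ scaledPattern S' N) :
    (Real.sqrt N)⁻¹ * Real.sqrt M ≤ dist x y := by
  obtain ⟨v, hv, rfl⟩ := Finset.mem_image.1 hx
  obtain ⟨w, hw, rfl⟩ := Finset.mem_image.1 hy
  rw [dist_scaled]
  refine mul_le_mul_of_nonneg_left (Real.sqrt_le_sqrt ?_) (inv_nonneg.2 (Real.sqrt_nonneg _))
  exact_mod_cast hS v hv w hw

/-- Contact-pair counts are invariant under linear isometries. -/
theorem card_contactPairs_image_linearIsometry [DecidablePred fun p : E3 × E3 => dist p.1 p.2 = 1]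
    (A : E3 →ₗᵢ[ℝ] E3) (P : Finset E3) :
    ((P.image A ×ˢ P.image A).filter (fun p => dist p.1 p.2 = 1)).card =
      ((P ×ˢ P).filter (fun p => dist p.1 p.2 = 1)).card := by
  rw [← Finset.prodMap_image_product, Finset.filter_image,
    Finset.card_image_of_injective _ (A.injective.prodMap A.injective)]
  congr 1
  exact Finset.filter_congr fun p _ => by simp [Prod.map, A.isometry.dist_eq]

/-- A finite set whose contact-pair count differs from `48` is not a linear-isometric image of the
FCC nor of the HCP pattern. -/
theorem not_isometricImage_of_card_contactPairs_ne [DecidablePred fun p : E3 × E3 => dist p.1 p.2 = 1]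
    {N : Finset E3} (hN : ((N ×ˢ N).filter (fun p => dist p.1 p.2 = 1)).card ≠ 48) :
    ¬ ∃ A : E3 →ₗᵢ[ℝ] E3,
      (↑N : Set E3) = A '' (↑fccKissingPattern : Set E3) ∨
        (↑N : Set E3) = A '' (↑hcpKissingPattern : Set E3) := by
  rintro ⟨A, h | h⟩
  · have hN' : N = fccKissingPattern.image A := by
      rw [← Finset.coe_inj, Finset.coe_image]; exact h
    apply hN
    rw [hN', card_contactPairs_image_linearIsometry, card_contactPairs_fcc]
  · have hN' : N = hcpKissingPattern.image A := by
      rw [← Finset.coe_inj, Finset.coe_image]; exact h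
    apply hN
    rw [hN', card_contactPairs_image_linearIsometry, card_contactPairs_hcp]

/-! ### The own pattern `1743` -/

/-- Integer model (frame of `hcpInt`, norm² `18`) of the hcp own-pattern `1743`: the four
consecutive hexagon vectors `(3,0,−3), (0,3,−3), (−3,3,0), (−3,0,3)` of the layer `x+y+z = 0`, two
vectors of the upper triangle `(3,3,0), (0,3,3)` and the two eclipsed vectors of the lower triangle
`(−1,−1,−4), (−4,−1,−1)` — the eight neighbours of a ball of an hcp grain on one side of a prism
plane. -/
def hcpOwn1743Int : Finset (Fin 3 → ℤ) :=
  {![3, 0, -3], ![0, 3, -3], ![-3, 3, 0], ![-3, 0, 3], ![3, 3, 0], ![0, 3, 3], ![-1, -1, -4],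
   ![-4, -1, -1]}

/-- The own pattern `O₁₇₄₃` as unit vectors. -/
def hcpOwn1743 : Finset E3 := scaledPattern hcpOwn1743Int 18

/-- Integer-model bookkeeping for the kernel witness (checked by `decide` / rescaling). -/
private theorem hcpOwn1743Int_subset : hcpOwn1743Int ⊆ hcpInt := by decide
/-- Integer-model bookkeeping for the kernel witness (checked by `decide` / rescaling). -/
private theorem card_hcpOwn1743Int : hcpOwn1743Int.card = 8 := by decide

/-- `O₁₇₄₃` consists of eight of the twelve HCP vectors. -/
theorem hcpOwn1743_subset_hcp : hcpOwn1743 ⊆ hcpKissingPattern :=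
  Finset.image_subset_image hcpOwn1743Int_subset

/-- Eight own vectors. -/
theorem card_hcpOwn1743 : hcpOwn1743.card = 8 := by
  rw [hcpOwn1743, card_scaledPattern _ (by norm_num), card_hcpOwn1743Int]

/-- The own model at scale `k = 8655`. -/
def hcpOwn1743Int8655 : Finset (Fin 3 → ℤ) :=
  {![25965, 0, -25965], ![0, 25965, -25965], ![-25965, 25965, 0], ![-25965, 0, 25965],
   ![25965, 25965, 0], ![0, 25965, 25965], ![-8655, -8655, -34620], ![-34620, -8655, -8655]}

/-- Integer-model bookkeeping for the kernel witness (checked by `decide` / rescaling). -/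
private theorem hcpOwn1743Int8655_eq :
    hcpOwn1743Int8655 = hcpOwn1743Int.image fun v => ((8655 : ℕ) : ℤ) • v := by decide

/-- Integer-model bookkeeping for the kernel witness (checked by `decide` / rescaling). -/
private theorem hcpOwn1743_eq : hcpOwn1743 = scaledPattern hcpOwn1743Int8655 1348362450 := by
  rw [hcpOwn1743Int8655_eq, show (1348362450 : ℕ) = 8655 ^ 2 * 18 by norm_num,
    scaledPattern_rescale _ (by norm_num), hcpOwn1743]

/-- The HCP model at scale `8655`. -/
def hcpInt8655 : Finset (Fin 3 → ℤ) :=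
  {![25965, -25965, 0], ![-25965, 25965, 0], ![25965, 0, -25965], ![-25965, 0, 25965],
   ![0, 25965, -25965], ![0, -25965, 25965], ![25965, 25965, 0], ![25965, 0, 25965],
   ![0, 25965, 25965], ![-8655, -8655, -34620], ![-8655, -34620, -8655], ![-34620, -8655, -8655]}

/-- Integer-model bookkeeping for the kernel witness (checked by `decide` / rescaling). -/
private theorem hcpInt8655_eq : hcpInt8655 = hcpInt.image fun v => ((8655 : ℕ) : ℤ) • v := by decide

/-- Integer-model bookkeeping for the kernel witness (checked by `decide` / rescaling). -/
private theorem hcpKissingPattern_eq : hcpKissingPattern = scaledPattern hcpInt8655 1348362450 := by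
  rw [hcpInt8655_eq, show (1348362450 : ℕ) = 8655 ^ 2 * 18 by norm_num,
    scaledPattern_rescale _ (by norm_num), hcpKissingPattern]

/-! ### The twisted square and the twisted dozen -/

/-- Integer model (scale `√1348362450 = 8655·√18`) of the TWISTED SQUARE: four free unit vectors,
two `C₂`-orbits, about `0.001 rad` from the numerical optimum of SLOTEX row A12-1743. -/
def twistedInt : Finset (Fin 3 → ℤ) :=
  {![33660, -12429, 7803], ![-11553, -31785, 14304], ![11553, -31785, -14304], ![8720, -8761, 34577]}

/-- The twisted square as unit vectors. -/
def twistedFour : Finset E3 := scaledPattern twistedInt 1348362450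

/-- Integer model of the twisted dozen: own pattern (scale `8655`) and twisted square. -/
def twistedDozenInt : Finset (Fin 3 → ℤ) := hcpOwn1743Int8655 ∪ twistedInt

/-- **The twisted dozen**: `O₁₇₄₃ ∪ F`. -/
def twistedDozen : Finset E3 := scaledPattern twistedDozenInt 1348362450

/-! ### Integer checks (`decide`) -/

/-- Integer-model bookkeeping for the kernel witness (checked by `decide` / rescaling). -/
private theorem card_twistedInt : twistedInt.card = 4 := by decide
/-- Integer-model bookkeeping for the kernel witness (checked by `decide` / rescaling). -/
private theorem card_twistedDozenInt : twistedDozenInt.card = 12 := by decide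
/-- Integer-model bookkeeping for the kernel witness (checked by `decide` / rescaling). -/
private theorem sqNormInt_twistedDozenInt : ∀ v ∈ twistedDozenInt, sqNormInt v = (1348362450 : ℕ) := by
  decide
/-- non-overlap: all pairs `≥ N` -/
private theorem sqNormInt_sub_twistedDozenInt :
    ∀ v ∈ twistedDozenInt, ∀ w ∈ twistedDozenInt, v ≠ w →
      ((1348362450 : ℕ) : ℤ) ≤ sqNormInt (v - w) := by
  decide
/-- clearance of the free four: `≥ 1352093634 > (1001/1000)² N` from everything else -/
private theorem sqNormInt_sub_twistedInt :
    ∀ v ∈ twistedInt, ∀ w ∈ twistedDozenInt, v ≠ w → ((1352093634 : ℕ) : ℤ) ≤ sqNormInt (v - w) := by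
  decide
/-- off the exact positions: `≥ 303323130 ≥ (9/20)² N` from every HCP vector -/
private theorem sqNormInt_sub_twistedInt_hcpInt8655 :
    ∀ v ∈ twistedInt, ∀ w ∈ hcpInt8655, ((303323130 : ℕ) : ℤ) ≤ sqNormInt (v - w) := by
  decide
/-- `26` ordered contact pairs (the `13` bonds inside the own pattern) -/
private theorem card_contactPairs_twistedDozenInt :
    ((twistedDozenInt ×ˢ twistedDozenInt).filter
      (fun p => sqNormInt (p.1 - p.2) = ((1348362450 : ℕ) : ℤ))).card = 26 := by
  decide

/-- Integer-model bookkeeping for the kernel witness (checked by `decide` / rescaling). -/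
private theorem twisted_gap :
    (1001 / 1000 : ℝ) < (Real.sqrt (1348362450 : ℕ))⁻¹ * Real.sqrt (1352093634 : ℕ) := by
  have hpos : (0 : ℝ) < Real.sqrt (1348362450 : ℕ) := by positivity
  rw [lt_inv_mul_iff₀ hpos, Real.lt_sqrt (by positivity), mul_pow, Real.sq_sqrt (by positivity)]
  norm_num

/-- Integer-model bookkeeping for the kernel witness (checked by `decide` / rescaling). -/
private theorem twisted_slot_gap :
    (9 / 20 : ℝ) ≤ (Real.sqrt (1348362450 : ℕ))⁻¹ * Real.sqrt (303323130 : ℕ) := by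
  have hpos : (0 : ℝ) < Real.sqrt (1348362450 : ℕ) := by positivity
  rw [le_inv_mul_iff₀ hpos, Real.le_sqrt (by positivity) (by positivity), mul_pow,
    Real.sq_sqrt (by positivity)]
  norm_num

/-! ### Real statements -/

/-- `twistedDozen = O₁₇₄₃ ∪ F`. -/
theorem twistedDozen_eq : twistedDozen = hcpOwn1743 ∪ twistedFour := by
  rw [hcpOwn1743_eq, twistedDozen, twistedDozenInt, scaledPattern, Finset.image_union]
  rfl

/-- The own pattern is part of the twisted dozen. -/
theorem hcpOwn1743_subset_twistedDozen : hcpOwn1743 ⊆ twistedDozen := by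
  rw [twistedDozen_eq]; exact Finset.subset_union_left

/-- The twisted square is part of the twisted dozen. -/
theorem twistedFour_subset_twistedDozen : twistedFour ⊆ twistedDozen :=
  Finset.image_subset_image Finset.subset_union_right

/-- Twelve balls. -/
theorem card_twistedDozen : twistedDozen.card = 12 := by
  rw [twistedDozen, card_scaledPattern _ (by norm_num), card_twistedDozenInt]

/-- Four free balls. -/
theorem card_twistedFour : twistedFour.card = 4 := by
  rw [twistedFour, card_scaledPattern _ (by norm_num), card_twistedInt]

/-- Unit vectors. -/
theorem norm_eq_one_of_mem_twistedDozen {x : E3} (hx : x ∈ twistedDozen) : ‖x‖ = 1 :=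
  norm_eq_one_of_mem_scaledPattern (by norm_num) sqNormInt_twistedDozenInt hx

/-- **The twisted dozen is a kissing arrangement** (twelve unit vectors pairwise `≥ 1` apart)
containing the exact hcp own-pattern `1743`. -/
theorem isKissingArrangement_twistedDozen : IsKissingArrangement twistedDozen :=
  ⟨fun _ hx => norm_eq_one_of_mem_twistedDozen hx,
    fun _ hx _ hy hxy =>
      one_le_dist_of_mem_scaledPattern (by norm_num) sqNormInt_sub_twistedDozenInt hx hy hxy⟩

/-- **The free balls touch nothing**: distance `> 1001/1000` from every other ball of the dozen. -/
theorem lt_dist_of_mem_twistedFour {x y : E3} (hx : x ∈ twistedFour) (hy : y ∈ twistedDozen)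
    (hxy : x ≠ y) : (1001 / 1000 : ℝ) < dist x y :=
  twisted_gap.trans_le (le_dist_of_mem_scaledPattern₂ sqNormInt_sub_twistedInt hx hy hxy)

/-- **The free balls are far from every exact position**: distance `≥ 9/20` (angle `≥ 26°`) from
each of the twelve HCP vectors (in particular from the four exact continuation positions of
`O₁₇₄₃`). -/
theorem le_dist_twistedFour_hcp {x p : E3} (hx : x ∈ twistedFour) (hp : p ∈ hcpKissingPattern) :
    (9 / 20 : ℝ) ≤ dist x p := by
  rw [hcpKissingPattern_eq] at hp
  exact twisted_slot_gap.trans (le_dist_of_mem_scaledPattern₂' sqNormInt_sub_twistedInt_hcpInt8655 hx hp)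

/-- The free four and the own eight are disjoint. -/
theorem disjoint_hcpOwn1743_twistedFour : Disjoint hcpOwn1743 twistedFour := by
  rw [Finset.disjoint_right]
  intro x hx hx'
  have h := le_dist_twistedFour_hcp hx (hcpOwn1743_subset_hcp hx')
  rw [dist_self] at h
  linarith

/-- **Bond count `13`** (`26` ordered contact pairs, all inside the own pattern), against `24`
bonds (`48` ordered pairs) for the FCC and HCP dozens. -/
theorem card_contactPairs_twistedDozen [DecidablePred fun p : E3 × E3 => dist p.1 p.2 = 1] :
    ((twistedDozen ×ˢ twistedDozen).filter (fun p => dist p.1 p.2 = 1)).card = 26 := by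
  rw [twistedDozen, card_contactPairs_scaledPattern _ (by norm_num)]
  exact card_contactPairs_twistedDozenInt

/-- **The twisted dozen is not a close-packed dozen**: not a linear-isometric image of the FCC nor
of the HCP pattern (bond count `13 ≠ 24`). With cf-p1's `IsClosePackedDozenAt 0` /
`ExactOnly 0` (ExactOnlySketch.lean) this reads `¬ ExactOnly 0 hcpOwn1743`. -/
theorem twistedDozen_not_isometricImage :
    ¬ ∃ A : E3 →ₗᵢ[ℝ] E3,
      (↑twistedDozen : Set E3) = A '' (↑fccKissingPattern : Set E3) ∨
        (↑twistedDozen : Set E3) = A '' (↑hcpKissingPattern : Set E3) := by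
  classical
  exact not_isometricImage_of_card_contactPairs_ne (by rw [card_contactPairs_twistedDozen]; norm_num)

/-- **Flexibility with the own pattern held fixed**: any four unit vectors `1/2500`-matched to the
twisted square complete `O₁₇₄₃` to a kissing dozen whose free balls still touch nothing — the
non-exact completions form an open (`8`-dimensional) family, not an isolated point. -/
theorem isKissingArrangement_own_union_of_etaMatched {η : ℝ} (hη : η ≤ 1 / 2500) {M : Finset E3}
    (hM : ∀ x ∈ M, ‖x‖ = 1) (hm : EtaMatched η M twistedFour) :
    IsKissingArrangement (hcpOwn1743 ∪ M) ∧
      ∀ x ∈ M, ∀ y ∈ hcpOwn1743 ∪ M, y ≠ x → 1 < dist x y := by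
  obtain ⟨e, he⟩ := hm
  have hMP : ∀ x ∈ M, ∀ y ∈ hcpOwn1743, 1 < dist x y := by
    intro x hx y hy
    have hx' : ((e ⟨x, hx⟩ : ↥twistedFour) : E3) ∈ twistedFour := (e ⟨x, hx⟩).2
    have hne : ((e ⟨x, hx⟩ : ↥twistedFour) : E3) ≠ y := by
      intro h
      have h2 := le_dist_twistedFour_hcp hx' (hcpOwn1743_subset_hcp hy)
      rw [h, dist_self] at h2
      linarith
    have hgap := lt_dist_of_mem_twistedFour hx' (hcpOwn1743_subset_twistedDozen hy) hne
    have h1 : dist x (e ⟨x, hx⟩ : E3) ≤ η := he ⟨x, hx⟩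
    have htri : dist (e ⟨x, hx⟩ : E3) y ≤ dist (e ⟨x, hx⟩ : E3) x + dist x y := dist_triangle _ _ _
    rw [dist_comm (e ⟨x, hx⟩ : E3) x] at htri
    linarith
  have hMM : ∀ x ∈ M, ∀ y ∈ M, x ≠ y → 1 < dist x y := by
    intro x hx y hy hxy
    have hne : ((e ⟨x, hx⟩ : ↥twistedFour) : E3) ≠ (e ⟨y, hy⟩ : E3) := by
      intro h
      have : e ⟨x, hx⟩ = e ⟨y, hy⟩ := Subtype.ext h
      rw [e.injective.eq_iff, Subtype.mk.injEq] at this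
      exact hxy this
    have hgap := lt_dist_of_mem_twistedFour (e ⟨x, hx⟩).2
      (twistedFour_subset_twistedDozen (e ⟨y, hy⟩).2) hne
    have h1 : dist x (e ⟨x, hx⟩ : E3) ≤ η := he ⟨x, hx⟩
    have h2 : dist y (e ⟨y, hy⟩ : E3) ≤ η := he ⟨y, hy⟩
    have htri : dist (e ⟨x, hx⟩ : E3) (e ⟨y, hy⟩ : E3) ≤ dist (e ⟨x, hx⟩ : E3) x + dist x y +
        dist y (e ⟨y, hy⟩ : E3) := dist_triangle4 _ _ _ _
    rw [dist_comm (e ⟨x, hx⟩ : E3) x] at htri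
    linarith
  refine ⟨⟨?_, ?_⟩, ?_⟩
  · intro x hx
    rcases Finset.mem_union.1 hx with hx | hx
    · exact norm_eq_one_of_mem_hcpKissingPattern (hcpOwn1743_subset_hcp hx)
    · exact hM x hx
  · intro x hx y hy hxy
    rcases Finset.mem_union.1 hx with hx | hx <;> rcases Finset.mem_union.1 hy with hy | hy
    · exact one_le_dist_of_mem_hcpKissingPattern (hcpOwn1743_subset_hcp hx)
        (hcpOwn1743_subset_hcp hy) hxy
    · rw [dist_comm]; exact (hMP y hy x hx).le
    · exact (hMP x hx y hy).le
    · exact (hMM x hx y hy hxy).le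
  · intro x hx y hy hyx
    rcases Finset.mem_union.1 hy with hy | hy
    · exact hMP x hx y hy
    · exact hMM x hx y hy (Ne.symm hyx)

/-- **Summary (hcp own-pattern `1743` is not exact-only).** There is a twelve-point kissing
arrangement `N ⊇ O₁₇₄₃` which is not a linear-isometric image of the FCC nor of the HCP pattern,
whose four non-own balls are `≥ 9/20` from every HCP vector and `> 1001/1000` from every other
ball. -/
theorem hcpOwn1743_not_exactOnly :
    ∃ N : Finset E3, hcpOwn1743 ⊆ N ∧ N.card = 12 ∧ IsKissingArrangement N ∧
      (¬ ∃ A : E3 →ₗᵢ[ℝ] E3,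
        (↑N : Set E3) = A '' (↑fccKissingPattern : Set E3) ∨
          (↑N : Set E3) = A '' (↑hcpKissingPattern : Set E3)) ∧
      (∀ x ∈ N \ hcpOwn1743, ∀ p ∈ hcpKissingPattern, (9 / 20 : ℝ) ≤ dist x p) ∧
      ∀ x ∈ N \ hcpOwn1743, ∀ y ∈ N, y ≠ x → (1001 / 1000 : ℝ) < dist x y := by
  have hdiff : twistedDozen \ hcpOwn1743 = twistedFour := by
    rw [twistedDozen_eq, Finset.union_sdiff_left,
      Finset.sdiff_eq_self_of_disjoint disjoint_hcpOwn1743_twistedFour.symm]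
  refine ⟨twistedDozen, hcpOwn1743_subset_twistedDozen, card_twistedDozen,
    isKissingArrangement_twistedDozen, twistedDozen_not_isometricImage, ?_, ?_⟩
  · intro x hx p hp
    rw [hdiff] at hx
    exact le_dist_twistedFour_hcp hx hp
  · intro x hx y hy hyx
    rw [hdiff] at hx
    exact lt_dist_of_mem_twistedFour hx hy (Ne.symm hyx)

end Summit.Ventures.Crystal3D.Theorems

end
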